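import Mathlib
import Summits.MatrixMultiplication.Statement
import Summits.MatrixMultiplication.MatrixMultiplication.Theorems.GraphEquationsJetRegularity

/-!
# GraphEquations — PURE PARTS: the specialised jets of the tests bound every initially isolated
# family in the test ideal (M19a, decomp-mm-lens-5 g32)

(supports `MultiplicityReduction`, stmt-MatrixMultiplication-27806; finite range of BOP′.)

Notation.  Over a base `y = (A₀,B₀)` write a polynomial `w ∈ ℂ[A,B,C]` in the `Ψ`-coordinates
`(A, B, F = C - AB)` as `Ψ⁻¹ w = liftF w ∈ ℂ[A,B][F]`, and let `(Ψ⁻¹ w)_ν` be its `F`-degree-`ν`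
component.  The **pure part of order `ν` of `w` over `y`** is the form
`P_{w,ν}(y) := map (eval y) (Ψ⁻¹ w)_ν ∈ ℂ[F]_ν` — the `F`-jet of `w` with its `ℂ[A,B]`-coefficients
frozen at `y` (in Lean, for the `o`-th test of a system `E`:
`map (eval y) (homogeneousComponent ν (liftF n (E.testPoly (E.tests.get o))))`; this module keeps the
term explicit and introduces no definitions); at `ν = 1` it is the row pairing
`F ↦ (J_C(graphPoint y) F)_o` of the `C`-Jacobian (`EqSystem.eval_purePart_one`).

* the JET CHARACTER at `F₀` — the ring map `ℂ[A,B][F] → ℂ[ε]`, `g ↦ g(0)`, `F_q ↦ F₀_q ε`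
  (`eval₂Hom (Polynomial.C.comp (eval 0)) (fun q => C (F₀ q) * X)`); its `ε^ν`-coefficient is
  `P_{·,ν}(0)` evaluated at `F₀` (`coeff_jetChar`).  Being a ring map, it turns the missing
  `homogeneousComponent`-of-a-product formula into `Polynomial.coeff_mul`.
* `eq_zero_of_pureParts_vanish` — **(system-free, base `0`)** if the tests `t_o` vanish on `W_n` and a
  family `u ⊆ (t)` is initially isolated to order `K` over `0` (`InitIsolatedFam u K 0`), then the
  pure parts `{P_{t_o,ν}(0) : o, 1 ≤ ν ≤ K}` of the TESTS already have the trivial common zero only.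
  Mechanism: a member `u_i = Σ_o h_{io} t_o` has `jetChar (Ψ⁻¹ u_i) = Σ_o jetChar(Ψ⁻¹ h_{io})·jetChar(Ψ⁻¹ t_o)`,
  and `jetChar(Ψ⁻¹ t_o) ∈ (ε^{K+1})` at a common zero `F₀` of the test pure parts (the `ε⁰`-coefficient
  vanishes because `t_o` vanishes on `W_n`), so the specialised initial form of `u_i`, of degree
  `ν_i ≤ K`, vanishes at `F₀` too; the isolation clause of the family forces `F₀ = 0`.
* JET ISOLATION of order `K` over `y` := the pure parts of the tests of orders `1 … K` over `y` have
  fibre `{0}` through `0`.  `EqSystem.IdealInitIsolatedAt.pureParts_trivialZero` — **`E` correct ∧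
  IdealInitIsolatedAt K y ⇒ jet isolation of order `K` over `y`** (any base, by the translation
  symmetry `τ_y`); at `K = 1` jet isolation is `ker J_C(graphPoint y) = 0` (`eval_purePart_one`).
* `EqSystem.not_idealInitIsolatedAt_of_pureParts_vanish` — the contrapositive, a ONE-LINE REFUTATION
  INSTRUMENT for rungs of BOP′: to show that the test ideal of a correct system is NOT initially
  isolated to order `K` over `y` it suffices to exhibit one `F₀ ≠ 0` killing the finitely many test
  pure parts of orders `≤ K` — no quantification over ideal members (compare the order-`e` power
  witnesses of module `GraphEquationsInitialIdeal`, which needed `t_o ∈ (F)^e`).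

Remark (recorded in the cell memo NODE-g32, not used here): the converse fails — jet isolation of
order `K` does not give ideal isolation of any order bounded in terms of `K` (tests
`g·f₁ + h·f₂ + f₂², f₁^k, f₂^k` are jet-isolated to order `2` and ideal-isolated to order exactly `k`),
and it is the IDEAL order that bounds the number of affine-jet deflation steps; the jet order is the
lower envelope of the finite range.

No `sorry`.  Sources: [LeykinVerscheldeZhao2006, §3]; [DaytonZeng2005, §3 (dual spaces of
initial ideals)]; tree modules `GraphEquationsInitialIdeal` (M14b), `GraphEquationsJetRegularity` (M18c).
-/

set_option linter.dupNamespace false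

noncomputable section

open scoped BigOperators Polynomial

namespace Summit.MatrixMultiplication.MatrixMultiplication.Theorems.GraphEquations

open MvPolynomial
open Literature.Computability.AlgebraicComplexity

variable {n : ℕ}

/-! ## The jet character -/

/-- A product of scaled variables `Π_q (c_q ε)^{d_q}` is `(Π_q c_q^{d_q}) ε^{|d|}`. -/
theorem finsupp_prod_C_mul_X_pow (c : Fin n × Fin n → ℂ) (d : Fin n × Fin n →₀ ℕ) :
    (d.prod fun q e => (Polynomial.C (c q) * Polynomial.X) ^ e) =
      Polynomial.C (d.prod fun q e => c q ^ e) * Polynomial.X ^ d.degree := by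
  simp only [Finsupp.prod, mul_pow, ← map_pow, Finset.prod_mul_distrib, ← map_prod,
    Finset.prod_pow_eq_pow_sum, Finsupp.degree_apply]

/-- **The `ε^ν`-coefficient of the JET CHARACTER at `F₀`** — the ring map `ℂ[A,B][F] → ℂ[ε]`,
`g ↦ g(0)` on coefficients, `F_q ↦ F₀_q · ε` — **is the specialised degree-`ν` component evaluated
at `F₀`.** -/
theorem coeff_jetChar (F₀ : Fin n × Fin n → ℂ) (P : FPoly n) (ν : ℕ) :
    (eval₂Hom (Polynomial.C.comp (eval (0 : MatMulVars n → ℂ)))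
        (fun q : Fin n × Fin n => Polynomial.C (F₀ q) * Polynomial.X) P).coeff ν =
      eval F₀ (map (eval (0 : MatMulVars n → ℂ)) (homogeneousComponent ν P)) := by
  induction P using MvPolynomial.induction_on' with
  | monomial d g =>
    rw [eval₂Hom_monomial, finsupp_prod_C_mul_X_pow, RingHom.comp_apply, ← mul_assoc,
      ← map_mul, Polynomial.coeff_C_mul_X_pow,
      homogeneousComponent_of_mem ((mem_homogeneousSubmodule _ _).mpr (isHomogeneous_monomial g rfl))]
    split_ifs with h
    · rw [map_monomial, eval_monomial]
    · rw [map_zero, map_zero]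
  | add p q hp hq => rw [map_add, Polynomial.coeff_add, hp, hq, map_add, map_add, map_add]

/-- A specialised component of positive degree vanishes at `F = 0`. -/
theorem eval_zero_map_homogeneousComponent (y : MatMulVars n → ℂ) (P : FPoly n) {ν : ℕ} (hν : 1 ≤ ν) :
    eval (0 : Fin n × Fin n → ℂ) (map (eval y) (homogeneousComponent ν P)) = 0 := by
  rw [MvPolynomial.eval_zero, constantCoeff_eq]
  exact ((homogeneousComponent_isHomogeneous ν P).map (eval y)).coeff_eq_zero (by rw [map_zero]; omega)

/-! ## Pure parts of the tests bound initially isolated families of members (base `0`) -/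

/-- **PURE PARTS (family level, base `0`).**  Let the tests `t_o` vanish on `W_n` and let
`u ⊆ (t_0,…,t_{S-1})` be initially isolated to order `K` over `0`.  If `F₀` is a common zero of the
pure parts `P_{t_o,ν}(0)`, `1 ≤ ν ≤ K`, of the tests, then `F₀ = 0`. -/
theorem eq_zero_of_pureParts_vanish {S T K : ℕ} (t : Fin S → MvPolynomial (GraphVars n) ℂ)
    (ht : ∀ o, ∀ x ∈ mmGraph n, eval x (t o) = 0)
    {u : Fin T → MvPolynomial (GraphVars n) ℂ} (hu : ∀ i, u i ∈ Ideal.span (Set.range t))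
    (hfam : InitIsolatedFam u K 0) (F₀ : Fin n × Fin n → ℂ)
    (hF : ∀ o ν, 1 ≤ ν → ν ≤ K →
      eval F₀ (map (eval (0 : MatMulVars n → ℂ)) (homogeneousComponent ν (liftF n (t o)))) = 0) :
    F₀ = 0 := by
  classical
  obtain ⟨ν, G, hν, hG, hlow, hiso⟩ := hfam
  choose g hg using fun i => Ideal.mem_span_range_iff_exists_fun.mp (hu i)
  have hGi : ∀ i, G i = liftF n (u i) := fun i => by rw [← liftF_substF (G i), hG]
  -- the jet character at `F`
  let jetChar : (Fin n × Fin n → ℂ) → (FPoly n →+* ℂ[X]) := fun F =>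
    eval₂Hom (Polynomial.C.comp (eval (0 : MatMulVars n → ℂ))) fun q => Polynomial.C (F q) * Polynomial.X
  have coeff_jetChar' : ∀ (F : Fin n × Fin n → ℂ) (P : FPoly n) (μ : ℕ), (jetChar F P).coeff μ =
      eval F (map (eval (0 : MatMulVars n → ℂ)) (homogeneousComponent μ P)) := fun F P μ =>
    coeff_jetChar F P μ
  -- at a common zero `F` of the test pure parts of orders `1 … K`, the jet characters of the tests,
  -- hence of the members, vanish to order `K`
  have hT : ∀ F : Fin n × Fin n → ℂ,
      (∀ o μ, 1 ≤ μ → μ ≤ K → eval F (map (eval (0 : MatMulVars n → ℂ))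
        (homogeneousComponent μ (liftF n (t o)))) = 0) →
      ∀ o μ, μ ≤ K → (jetChar F (liftF n (t o))).coeff μ = 0 := by
    intro F hF' o μ hμ
    rw [coeff_jetChar']
    rcases Nat.eq_zero_or_pos μ with rfl | hpos
    · rw [homogeneousComponent_zero_liftF_eq_zero (ht o), map_zero, map_zero]
    · exact hF' o μ hpos hμ
  have hU : ∀ F : Fin n × Fin n → ℂ,
      (∀ o μ, 1 ≤ μ → μ ≤ K → eval F (map (eval (0 : MatMulVars n → ℂ))
        (homogeneousComponent μ (liftF n (t o)))) = 0) →
      ∀ i μ, μ ≤ K → (jetChar F (G i)).coeff μ = 0 := by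
    intro F hF' i μ hμ
    rw [hGi, ← hg i, map_sum, map_sum, Polynomial.finsetSum_coeff]
    refine Finset.sum_eq_zero fun o _ => ?_
    rw [map_mul, map_mul, Polynomial.coeff_mul]
    refine Finset.sum_eq_zero fun x hx => ?_
    have hx2 : x.2 ≤ K := by have := Finset.HasAntidiagonal.mem_antidiagonal.mp hx; omega
    rw [hT F hF' o x.2 hx2, mul_zero]
  refine hiso F₀ fun i => ?_
  rw [← coeff_jetChar', ← coeff_jetChar', hU F₀ hF i _ (hν i),
    hU 0 (fun o μ hμ _ => eval_zero_map_homogeneousComponent 0 _ hμ) i _ (hν i)]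

/-! ## Systems, any base -/

/-- `Ψ⁻¹ (τ_y^* w) = (shift of coefficients by y) (Ψ⁻¹ w)`: the translation symmetry acts on the
`Ψ`-coordinates through the coefficient ring only. -/
theorem liftF_translate (y : MatMulVars n → ℂ) (w : MvPolynomial (GraphVars n) ℂ) :
    liftF n (GraphEquations.translate y w) = map (shiftAB y) (liftF n w) := by
  rw [← liftF_substF (map (shiftAB y) (liftF n w)), ← translate_substF, substF_liftF]

namespace EqSystem

/-- The pure parts over `y` (the `F`-degree-`ν` component of `Ψ⁻¹ t_o` with its `ℂ[A,B]`-coefficients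
evaluated at `y`) are the base-`0` pure parts of the translated tests `τ_y^* t_o`. -/
theorem purePart_eq_translate (E : EqSystem n) (y : MatMulVars n → ℂ) (o : Fin E.tests.length) (ν : ℕ) :
    map (eval (0 : MatMulVars n → ℂ))
        (homogeneousComponent ν (liftF n (GraphEquations.translate y (E.testPoly (E.tests.get o))))) =
      map (eval y) (homogeneousComponent ν (liftF n (E.testPoly (E.tests.get o)))) := by
  rw [liftF_translate, homogeneousComponent_map, map_map, eval_zero_comp_shiftAB]

/-- The order-`1` pure part over `y` is the row pairing of the `C`-Jacobian at the graph point, so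
jet isolation of order `1` over `y` is `ker J_C(graphPoint y) = 0`. -/
theorem eval_purePart_one (E : EqSystem n) (y : MatMulVars n → ℂ) (o : Fin E.tests.length)
    (γ : Fin n × Fin n → ℂ) :
    eval γ (map (eval y) (homogeneousComponent 1 (liftF n (E.testPoly (E.tests.get o))))) =
      (E.jacobianC (graphPoint y)).mulVec γ o := by
  rw [eval_map_homogeneousComponent_one_liftF]
  simp only [Matrix.mulVec, dotProduct, jacobianC, Matrix.of_apply]

/-- **PURE PARTS (systems, any base).**  For a correct system, ideal isolation of order `K` over `y`
implies JET ISOLATION of order `K` over `y`: the finitely many pure parts of the TESTS of orders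
`1 … K` over `y` already have the trivial common zero only. -/
theorem IdealInitIsolatedAt.pureParts_trivialZero {E : EqSystem n} (hE : E.Correct) {K : ℕ}
    {y : MatMulVars n → ℂ} (h : E.IdealInitIsolatedAt K y) (F₀ : Fin n × Fin n → ℂ)
    (hF : ∀ (o : Fin E.tests.length) (ν : ℕ), 1 ≤ ν → ν ≤ K →
      eval F₀ (map (eval y) (homogeneousComponent ν (liftF n (E.testPoly (E.tests.get o))))) = 0) :
    F₀ = 0 := by
  classical
  obtain ⟨T, u, hu, hfam⟩ := h
  set t : Fin E.tests.length → MvPolynomial (GraphVars n) ℂ := fun o =>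
    GraphEquations.translate y (E.testPoly (E.tests.get o)) with htdef
  have ht : ∀ o, ∀ x ∈ mmGraph n, eval x (t o) = 0 := fun o x hx =>
    eval_bind₁_shift_eq_zero (graphPoint_mem_mmGraph y)
      (fun z hz => hE.eval_testPoly_eq_zero hz (List.get_mem _ _)) hx
  have hu' : ∀ i, GraphEquations.translate y (u i) ∈ Ideal.span (Set.range t) := by
    intro i
    obtain ⟨g, hg⟩ := Ideal.mem_span_range_iff_exists_fun.mp (hu i)
    rw [← hg, GraphEquations.translate, map_sum]
    refine Ideal.sum_mem _ fun o _ => ?_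
    rw [map_mul]
    exact Ideal.mul_mem_left _ _ (Ideal.subset_span ⟨o, rfl⟩)
  refine eq_zero_of_pureParts_vanish t ht hu' hfam.translate F₀ fun o ν h1 hK => ?_
  rw [htdef, purePart_eq_translate]
  exact hF o ν h1 hK

/-- Tests initially isolated to order `K` over `y` ⇒ jet isolation of order `K` over `y`. -/
theorem InitIsolatedAt.pureParts_trivialZero {E : EqSystem n} (hE : E.Correct) {K : ℕ}
    {y : MatMulVars n → ℂ} (h : E.InitIsolatedAt K y) (F₀ : Fin n × Fin n → ℂ)
    (hF : ∀ (o : Fin E.tests.length) (ν : ℕ), 1 ≤ ν → ν ≤ K →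
      eval F₀ (map (eval y) (homogeneousComponent ν (liftF n (E.testPoly (E.tests.get o))))) = 0) :
    F₀ = 0 :=
  h.idealInitIsolatedAt.pureParts_trivialZero hE F₀ hF

/-- **Refutation instrument.**  One nonzero common zero of the test pure parts of orders `≤ K` over
`y` shows that the test IDEAL of a correct system is not initially isolated to order `K` over `y`. -/
theorem not_idealInitIsolatedAt_of_pureParts_vanish {E : EqSystem n} (hE : E.Correct) {K : ℕ}
    {y : MatMulVars n → ℂ} {F₀ : Fin n × Fin n → ℂ} (hF₀ : F₀ ≠ 0)
    (hF : ∀ (o : Fin E.tests.length) (ν : ℕ), 1 ≤ ν → ν ≤ K →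
      eval F₀ (map (eval y) (homogeneousComponent ν (liftF n (E.testPoly (E.tests.get o))))) = 0) :
    ¬ E.IdealInitIsolatedAt K y :=
  fun h => hF₀ (h.pureParts_trivialZero hE F₀ hF)

/-- In particular ideal isolation of order `K` over `y` forces SOME test to have a nonzero pure part
of some order `1 ≤ ν ≤ K` over `y` (for `n ≥ 1`). -/
theorem IdealInitIsolatedAt.exists_purePart_ne_zero {E : EqSystem n} (hn : 1 ≤ n) (hE : E.Correct)
    {K : ℕ} {y : MatMulVars n → ℂ} (h : E.IdealInitIsolatedAt K y) :
    ∃ (o : Fin E.tests.length) (ν : ℕ), 1 ≤ ν ∧ ν ≤ K ∧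
      map (eval y) (homogeneousComponent ν (liftF n (E.testPoly (E.tests.get o)))) ≠ 0 := by
  by_contra hne
  push Not at hne
  have i0 : Fin n := ⟨0, hn⟩
  have h1 : (fun _ : Fin n × Fin n => (1 : ℂ)) = 0 :=
    h.pureParts_trivialZero hE _ fun o ν h1 hK => by rw [hne o ν h1 hK, map_zero]
  exact one_ne_zero (congrFun h1 (i0, i0))

end EqSystem

end Summit.MatrixMultiplication.MatrixMultiplication.Theorems.GraphEquations

end
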